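import Summits.Ventures.PercRepro.RankLevelSetBoolInOut
import Summits.Ventures.PercRepro.RankLevelSetInOutTruncate

/-! # RankLevelSetBoolInOutFree — THE CELL'S (IO) HOLDS FOR EVERY FREE MATROID: `BiIndepInOutNormSkew (freeOn E)`
(night-1 g33; dossier §45.8)

The cell's conjecture (IO) (`RankLevelSetBiIndepUpSet`, dossier §44.3) for the free matroid `freeOn E` on a finite set
`E` and a family `U` up-closed among its flats (= all subsets of `E`) says `NormSkew (inOutCount (freeOn E) U) (#E + 1)`
with `inOutCount (freeOn E) U k = #{W ⊆ E : #W = k, W ∈ U, E ∖ W ∉ U}`. This is the Boolean (IO) of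
`RankLevelSetBoolInOut` for the intersecting up-set `V = {W' : Finset ↥E | W' ∈ U, E ∖ W' ∉ U}` of the subtype
`↥E`: the in-out family of an up-set is an up-set whose members avoid their complements, hence intersecting
(**`intersecting_of_compl_notMem`**), and `W' ↦ Subtype.val '' W'` carries its `k`-members bijectively onto the
in-out `k`-sets of `(freeOn E, U)` (**`inOutCount_freeOn_eq_levelCount`**). THEOREM **`biIndepInOutNormSkew_freeOn`**:
`E.Finite → BiIndepInOutNormSkew (freeOn E)`. With `RankLevelSetInOutTruncate` (the truncation closure of (IO)),
**`biIndepInOutNormSkew_truncateTo_freeOn`**: (IO) holds for every truncation of a free matroid, i.e. for EVERY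
UNIFORM MATROID with an arbitrary filter of flats. Every declaration has a docstring; imports: the cell's own modules
and Mathlib only. Axioms: standard. -/

namespace PercRepro

open Finset

namespace Cycle

variable {β : Type} [Fintype β] [DecidableEq β]

/-- **An up-set whose members avoid their complements is intersecting**: disjoint members `W₁, W₂` would give
`W₂ ⊆ univ ∖ W₁ ∈ V`. -/
lemma intersecting_of_compl_notMem {V : Finset (Finset β)} (hup : IsUpperSet (V : Set (Finset β)))
    (h : ∀ W ∈ V, univ \ W ∉ V) : (V : Set (Finset β)).Intersecting := by
  intro W₁ hW₁ W₂ hW₂ hdis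
  rw [Finset.mem_coe] at hW₁ hW₂
  apply h W₁ hW₁
  apply hup _ hW₂
  intro x hx
  rw [Finset.mem_sdiff]
  exact ⟨Finset.mem_univ _, fun hx₁ => Finset.disjoint_left.mp hdis hx₁ hx⟩

end Cycle

open Set

variable {α : Type}

/-- The flats of the free matroid on `E` are the subsets of `E`. -/
lemma freeOn_isFlat_iff (E F : Set α) : (Matroid.freeOn E).IsFlat F ↔ F ⊆ E := by
  rw [Matroid.isFlat_iff_closure_eq, Matroid.freeOn_closure_eq]
  constructor
  · intro h; rw [← h]; exact Set.inter_subset_right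
  · intro h; exact Set.inter_eq_left.mpr h

/-- The in-out `k`-sets of `(freeOn E, U)`: the `k`-subsets `W ⊆ E` with `W ∈ U` and `E ∖ W ∉ U`. -/
lemma inOutCount_freeOn (E : Set α) (U : Set (Set α)) (k : ℕ) :
    inOutCount (Matroid.freeOn E) U k = {W : Set α | W ⊆ E ∧ W.ncard = k ∧ W ∈ U ∧ E \ W ∉ U}.ncard := by
  unfold inOutCount biIndep
  congr 1
  ext W
  simp only [Set.mem_setOf_eq, Matroid.freeOn_ground, Matroid.freeOn_indep_iff, Matroid.freeOn_closure_eq]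
  constructor
  · rintro ⟨⟨hWE, hk, -, -⟩, hin, hout⟩
    rw [Set.inter_eq_left.mpr hWE] at hin
    rw [Set.inter_eq_left.mpr Set.sdiff_subset] at hout
    exact ⟨hWE, hk, hin, hout⟩
  · rintro ⟨hWE, hk, hin, hout⟩
    refine ⟨⟨hWE, hk, hWE, Set.sdiff_subset⟩, ?_, ?_⟩
    · rwa [Set.inter_eq_left.mpr hWE]
    · rwa [Set.inter_eq_left.mpr Set.sdiff_subset]

open Classical in
/-- **The in-out family of the free matroid, on the subtype `↥E`**: `W'` with `val '' W' ∈ U`, `E ∖ val '' W' ∉ U`. -/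
noncomputable def freeInOut (E : Set α) [Fintype E] [DecidableEq α] (U : Set (Set α)) : Finset (Finset E) :=
  Finset.univ.filter (fun W' : Finset E =>
    (Subtype.val '' (W' : Set E)) ∈ U ∧ E \ (Subtype.val '' (W' : Set E)) ∉ U)

/-- Membership in the in-out family. -/
lemma mem_freeInOut {E : Set α} [Fintype E] [DecidableEq α] {U : Set (Set α)} {W' : Finset E} :
    W' ∈ freeInOut E U ↔ (Subtype.val '' (W' : Set E)) ∈ U ∧ E \ (Subtype.val '' (W' : Set E)) ∉ U := by
  simp [freeInOut]

/-- The image of a finset of the subtype `↥E` lies in `E`. -/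
lemma image_val_subset {E : Set α} (W' : Finset E) : Subtype.val '' (W' : Set E) ⊆ E := by
  rintro x ⟨y, -, rfl⟩; exact y.2

/-- The image of the complement of `W'` is the complement of the image. -/
lemma image_val_compl {E : Set α} [Fintype E] [DecidableEq α] (W' : Finset E) :
    Subtype.val '' ((Finset.univ \ W' : Finset E) : Set E) = E \ Subtype.val '' (W' : Set E) := by
  ext x
  constructor
  · rintro ⟨y, hy, rfl⟩
    rw [Finset.mem_coe, Finset.mem_sdiff] at hy
    refine ⟨y.2, fun ⟨z, hz, hzy⟩ => hy.2 ?_⟩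
    rw [Finset.mem_coe] at hz
    rwa [Subtype.val_injective hzy] at hz
  · rintro ⟨hxE, hx⟩
    refine ⟨⟨x, hxE⟩, ?_, rfl⟩
    rw [Finset.mem_coe, Finset.mem_sdiff]
    exact ⟨Finset.mem_univ _, fun h => hx ⟨⟨x, hxE⟩, Finset.mem_coe.mpr h, rfl⟩⟩

/-- The in-out family is an up-set (for `U` up-closed among the flats of `freeOn E`). -/
lemma isUpperSet_freeInOut (E : Set α) [Fintype E] [DecidableEq α] {U : Set (Set α)}
    (hU : UpSetFlats (Matroid.freeOn E) U) : IsUpperSet ((freeInOut E U : Finset (Finset E)) : Set (Finset E)) := by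
  intro W₁ W₂ hle h
  rw [Finset.mem_coe, mem_freeInOut] at h ⊢
  obtain ⟨hin, hout⟩ := h
  have hsub : Subtype.val '' (W₁ : Set E) ⊆ Subtype.val '' (W₂ : Set E) :=
    Set.image_mono (Finset.coe_subset.mpr hle)
  refine ⟨hU _ hin _ ((freeOn_isFlat_iff E _).mpr (image_val_subset W₂)) hsub, ?_⟩
  intro h2
  exact hout (hU _ h2 _ ((freeOn_isFlat_iff E _).mpr Set.sdiff_subset) (Set.sdiff_subset_sdiff_right hsub))

/-- The in-out family avoids its complements. -/
lemma compl_notMem_freeInOut (E : Set α) [Fintype E] [DecidableEq α] (U : Set (Set α)) :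
    ∀ W' ∈ freeInOut E U, Finset.univ \ W' ∉ freeInOut E U := by
  intro W' hW' h
  rw [mem_freeInOut] at hW' h
  rw [image_val_compl, Set.sdiff_sdiff_cancel_left (image_val_subset W')] at h
  exact h.2 hW'.1

/-- **The `k`-members of the in-out family are the in-out `k`-sets of `(freeOn E, U)`**:
`inOutCount (freeOn E) U k = levelCount (freeInOut E U) k`. -/
lemma inOutCount_freeOn_eq_levelCount (E : Set α) [Fintype E] [DecidableEq α] (U : Set (Set α)) (k : ℕ) :
    inOutCount (Matroid.freeOn E) U k = Cycle.levelCount (freeInOut E U) k := by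
  classical
  have himage : ∀ {W : Set α} (hWE : W ⊆ E) (hWfin : W.Finite),
      Subtype.val '' ((hWfin.toFinset.subtype (· ∈ E) : Finset E) : Set E) = W := by
    intro W hWE hWfin
    ext x
    simp only [Set.mem_image, Finset.mem_coe, Finset.mem_subtype, Set.Finite.mem_toFinset]
    constructor
    · rintro ⟨y, hy, rfl⟩; exact hy
    · intro hx; exact ⟨⟨x, hWE hx⟩, hx, rfl⟩
  rw [inOutCount_freeOn, Cycle.levelCount]
  have hinj : Function.Injective (fun W' : Finset E => Subtype.val '' (W' : Set E)) := by
    intro W₁ W₂ h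
    exact Finset.coe_injective (Set.image_injective.mpr Subtype.val_injective h)
  have heq : {W : Set α | W ⊆ E ∧ W.ncard = k ∧ W ∈ U ∧ E \ W ∉ U} =
      (fun W' : Finset E => Subtype.val '' (W' : Set E)) '' (((freeInOut E U).filter (fun W' => W'.card = k) :
        Finset (Finset E)) : Set (Finset E)) := by
    ext W
    constructor
    · rintro ⟨hWE, hk, hin, hout⟩
      have hWfin : W.Finite := (Set.toFinite E).subset hWE
      refine ⟨hWfin.toFinset.subtype (· ∈ E), ?_, himage hWE hWfin⟩
      rw [Finset.mem_coe, Finset.mem_filter, mem_freeInOut]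
      refine ⟨⟨?_, ?_⟩, ?_⟩
      · rw [himage hWE hWfin]; exact hin
      · rw [himage hWE hWfin]; exact hout
      · rw [Finset.card_subtype, Finset.filter_true_of_mem (fun x hx => hWE (hWfin.mem_toFinset.mp hx)),
          ← Set.ncard_eq_toFinset_card W hWfin, hk]
    · rintro ⟨W', hW', rfl⟩
      rw [Finset.mem_coe, Finset.mem_filter, mem_freeInOut] at hW'
      obtain ⟨⟨hin, hout⟩, hk⟩ := hW'
      refine ⟨image_val_subset W', ?_, hin, hout⟩
      rw [Set.ncard_image_of_injective _ Subtype.val_injective, Set.ncard_coe_finset, hk]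
  rw [heq, Set.ncard_image_of_injective _ hinj, Set.ncard_coe_finset]

/-- **THE CELL'S (IO) FOR EVERY FREE MATROID** (night-1 g33): `BiIndepInOutNormSkew (freeOn E)` for finite `E`. -/
theorem biIndepInOutNormSkew_freeOn {E : Set α} (hE : E.Finite) : BiIndepInOutNormSkew (Matroid.freeOn E) := by
  classical
  haveI : Fintype E := hE.fintype
  intro U hU
  rw [Matroid.freeOn_ground]
  have hn : Fintype.card E = E.ncard := by
    rw [Set.ncard_eq_toFinset_card' E, Set.toFinset_card]
  have hup := isUpperSet_freeInOut E hU
  have hint := Cycle.intersecting_of_compl_notMem hup (compl_notMem_freeInOut E U)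
  have := Cycle.normSkew_levelCount_of_intersecting hn hint hup
  exact SkewConv.normSkew_congr this fun k _ => (inOutCount_freeOn_eq_levelCount E U k).symm

/-- **THE CELL'S (IO) FOR EVERY UNIFORM MATROID** (night-1 g33): every truncation `T_r (freeOn E)` of a free matroid
on a finite set — the uniform matroid `U_{r, #E}` — satisfies `BiIndepInOutNormSkew`, i.e. the normalized half rule
with parameter `#E + 1` for the in-out profile of EVERY family up-closed among its flats. -/
theorem biIndepInOutNormSkew_truncateTo_freeOn {E : Set α} (hE : E.Finite) (r : ℕ) :
    haveI : (Matroid.freeOn E).Finite := ⟨hE⟩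
    BiIndepInOutNormSkew (truncateTo (Matroid.freeOn E) r) := by
  haveI : (Matroid.freeOn E).Finite := ⟨hE⟩
  exact biIndepInOutNormSkew_truncateTo (Matroid.freeOn E) (biIndepInOutNormSkew_freeOn hE) r

end PercRepro
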